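import Literature.MathematicalPhysics.QuantumLattice.YangMillsHeatFlowDivBochner
import HarnessLib

/-!
# Evolution of `∇_A F` under the Yang–Mills heat flow and the Bochner inequality for `|∇_A F|²`

QuantumLattice support file (everything proved; no definitions, no named facts) on the proof
path of `Literature.MathematicalPhysics.QuantumLattice.Waldron2019_yangMillsFlow_flatTorus`
(A. Waldron, *Long-time existence for Yang–Mills flow*, Invent. math. 217 (2019)), §3: the
`k = 1` derivative estimate of the `ε`-regularity Proposition 3.1(a) (after [instantons] Lemma 3.1:
Bernstein–Hamilton-type derivative estimates of Weinkove). Flat space, frame form.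

For a jointly smooth solution `∂ₜA = div_A F_A` on an open time set `𝒯`:

* `covDeriv_lie_apply` — covariant Leibniz rule for the bracket, `D_w[φ, ψ] = [D_wφ, ψ] + [φ, D_wψ]`;
* `covDeriv_sum_covDeriv_covDeriv_eq` — the third-order commutator
  `D_w ∑ᵢ DᵢDᵢφ = ∑ᵢ DᵢDᵢ(D_wφ) + ∑ᵢ ([DᵢF_{wi}, φ] + 2[F_{wi}, Dᵢφ])`;
* `hasDerivAt_covDeriv_curvature_of_flow` — **evolution of `∇F`**:
  `∂ₜ (D_wF_{uv}) = ∑ᵢ DᵢDᵢ(D_wF_{uv}) + 2∑ᵢ ([F_{wi}, DᵢF_{uv}] + [D_wF_{ui}, F_{iv}] + [F_{ui}, D_wF_{iv}])`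
  (the terms `[DᵢF_{wi}, F_{uv}]` and `[Ȧ_w, F_{uv}]` cancel since `Ȧ_w = −∑ᵢ DᵢF_{wi}`);
* `deriv_gradDensity_sub_laplacian_le` — **Bochner inequality** for
  `N = ∑_{ijk} ‖DᵢF_{jk}‖²`: `∂ₜN − ∑ₗ∂ₗ∂ₗN ≤ −2∑‖DₗDᵢF_{jk}‖² + 24√2 (card ι) √e · N` — linear once
  `|F|` is bounded.

References: A. Waldron, Invent. math. 217 (2019), Prop. 3.1(a) [Waldron2019]; A. Waldron,
Calc. Var. PDE 55 (2016) = arXiv:1402.3224, Lemma 3.1 [Waldron2016]; B. Weinkove, Singularity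
formation in the Yang–Mills flow, Calc. Var. PDE 19 (2004), §2 (derivative estimates).
-/

noncomputable section

open scoped ContDiff Topology RealInnerProductSpace Matrix
open Set Filter

namespace Literature.MathematicalPhysics.QuantumLattice

/-! ### Covariant algebra: Leibniz rule for the bracket and the third-order commutator -/

section CovAlgebra

variable {E : Type*} [NormedAddCommGroup E] [InnerProductSpace ℝ E]
variable {𝔸 : Type*} [NormedRing 𝔸] [NormedAlgebra ℝ 𝔸]
variable {ι : Type*} [Fintype ι]

/-- **Covariant Leibniz rule for the bracket**: `D_w[φ, ψ] = [D_wφ, ψ] + [φ, D_wψ]` (product rule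
and the Jacobi identity for `[A_w, ·]`). Donaldson–Kronheimer §2.1.2. [folklore] -/
theorem covDeriv_lie_apply (A : Connection E 𝔸) {φ ψ : E → 𝔸} {x : E}
    (hφ : DifferentiableAt ℝ φ x) (hψ : DifferentiableAt ℝ ψ x) (w : E) :
    covDeriv A (fun y => ⁅φ y, ψ y⁆) x w = ⁅covDeriv A φ x w, ψ x⁆ + ⁅φ x, covDeriv A ψ x w⁆ := by
  have hφ' := hφ.hasFDerivAt
  have hψ' := hψ.hasFDerivAt
  have heq : (fun y => ⁅φ y, ψ y⁆) = fun y => φ y * ψ y - ψ y * φ y :=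
    funext fun y => Ring.lie_def _ _
  unfold covDeriv
  rw [heq, ((hφ'.fun_mul' hψ').fun_sub (hψ'.fun_mul' hφ')).fderiv]
  simp only [sub_apply, add_apply, smul_apply, smul_eq_mul, op_smul_eq_mul, Ring.lie_def]
  noncomm_ring

/-- `D_w(c • φ) = c • D_wφ` for a real scalar and a section differentiable at the point.
[folklore] -/
theorem covDeriv_fun_smul (A : Connection E 𝔸) (c : ℝ) {φ : E → 𝔸} {x : E}
    (hφ : DifferentiableAt ℝ φ x) (w : E) :
    covDeriv A (fun y => c • φ y) x w = c • covDeriv A φ x w := by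
  unfold covDeriv
  rw [show (fun y => c • φ y) = c • φ from rfl, fderiv_const_smul hφ c]
  simp only [smul_apply, Pi.smul_apply, Ring.lie_def, smul_add, mul_smul_comm, smul_mul_assoc,
    smul_sub]

/-- **Third-order commutator.** For a `C²` connection, a `C³` section `φ` and an orthonormal
frame `b`: `D_w ∑ᵢ Dᵢ(Dᵢφ) = ∑ᵢ DᵢDᵢ(D_wφ) + ∑ᵢ ([DᵢF(w,bᵢ), φ] + 2[F(w,bᵢ), Dᵢφ])`
(commute `D_w` through each `Dᵢ` with `[D_w, Dᵢ] = [F(w,bᵢ), ·]` and expand `Dᵢ[F, φ]` by the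
covariant Leibniz rule). [folklore] -/
theorem covDeriv_sum_covDeriv_covDeriv_eq (b : OrthonormalBasis ι ℝ E) (A : Connection E 𝔸)
    (hA : ContDiff ℝ 2 A) {φ : E → 𝔸} (hφ : ContDiff ℝ 3 φ) (x w : E) :
    covDeriv A (fun y => ∑ i, covDeriv A (fun z => covDeriv A φ z (b i)) y (b i)) x w =
      ∑ i, covDeriv A (fun y => covDeriv A (fun z => covDeriv A φ z w) y (b i)) x (b i) +
        ∑ i, (⁅covDeriv A (fun z => curvature A z w (b i)) x (b i), φ x⁆ +
          (2 : ℝ) • ⁅curvature A x w (b i), covDeriv A φ x (b i)⁆) := by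
  have hA1 : ContDiff ℝ 1 A := hA.of_le (by norm_num)
  have hφ2 : ContDiff ℝ 2 φ := hφ.of_le (by norm_num)
  have hφ21 : ContDiff ℝ (2 + 1) φ := by rw [show (2 : WithTop ℕ∞) + 1 = 3 by norm_num]; exact hφ
  have hφ11 : ContDiff ℝ (1 + 1) φ := by rw [show (1 : WithTop ℕ∞) + 1 = 2 by norm_num]; exact hφ2
  have hA11 : ContDiff ℝ (1 + 1) A := by rw [show (1 : WithTop ℕ∞) + 1 = 2 by norm_num]; exact hA
  -- regularity of the sections involved
  have hD2 : ∀ a, ContDiff ℝ 2 (fun z => covDeriv A φ z a) := fun a =>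
    contDiff_covDeriv_apply hA hφ21 a
  have hD11 : ∀ a, ContDiff ℝ (1 + 1) (fun z => covDeriv A φ z a) := fun a => by
    rw [show (1 : WithTop ℕ∞) + 1 = 2 by norm_num]; exact hD2 a
  have hDD1 : ∀ a c, ContDiff ℝ 1 (fun y => covDeriv A (fun z => covDeriv A φ z a) y c) :=
    fun a c => contDiff_covDeriv_apply hA1 (hD11 a) c
  have hDDd : ∀ a c y, DifferentiableAt ℝ (fun y => covDeriv A (fun z => covDeriv A φ z a) y c) y :=
    fun a c y => ((hDD1 a c).differentiable one_ne_zero) y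
  have hφd : ∀ y, DifferentiableAt ℝ φ y := fun y => (hφ.differentiable (by norm_num)) y
  have hDd : ∀ a y, DifferentiableAt ℝ (fun z => covDeriv A φ z a) y := fun a y =>
    ((hD2 a).differentiable two_ne_zero) y
  have hFd : ∀ a c y, DifferentiableAt ℝ (fun z => curvature A z a c) y := fun a c y =>
    ((contDiff_curvature_apply hA11 a c).differentiable one_ne_zero) y
  -- Step 1: linearity of the outer `D_w`
  rw [covDeriv_fun_sum Finset.univ A (fun i _ => hDDd (b i) (b i) x) w, ← Finset.sum_add_distrib]
  refine Finset.sum_congr rfl fun i _ => ?_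
  -- Step 2: `D_w Dᵢ (Dᵢφ) = Dᵢ D_w (Dᵢφ) + [F(w, bᵢ), Dᵢφ]`
  have h2 : covDeriv A (fun y => covDeriv A (fun z => covDeriv A φ z (b i)) y (b i)) x w =
      covDeriv A (fun y => covDeriv A (fun z => covDeriv A φ z (b i)) y w) x (b i) +
        ⁅curvature A x w (b i), covDeriv A φ x (b i)⁆ := by
    have h := covDeriv_covDeriv_sub_eq_lie A hA1 (hD2 (b i)) x w (b i)
    rw [sub_eq_iff_eq_add] at h
    rw [h, add_comm]
  -- Step 3: `D_w (Dᵢφ) = Dᵢ (D_wφ) + [F(w, bᵢ), φ]` as functions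
  have h3 : (fun y => covDeriv A (fun z => covDeriv A φ z (b i)) y w) =
      fun y => covDeriv A (fun z => covDeriv A φ z w) y (b i) + ⁅curvature A y w (b i), φ y⁆ := by
    funext y
    have h := covDeriv_covDeriv_sub_eq_lie A hA1 hφ2 y w (b i)
    rw [sub_eq_iff_eq_add] at h
    rw [h, add_comm]
  -- Step 4: `Dᵢ` of that sum, and the Leibniz rule for the bracket
  have hlie_d : DifferentiableAt ℝ (fun y => ⁅curvature A y w (b i), φ y⁆) x := by
    have heq : (fun y => ⁅curvature A y w (b i), φ y⁆) =
        fun y => curvature A y w (b i) * φ y - φ y * curvature A y w (b i) :=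
      funext fun y => Ring.lie_def _ _
    rw [heq]
    exact ((hFd w (b i) x).mul (hφd x)).sub ((hφd x).mul (hFd w (b i) x))
  rw [h2, h3, covDeriv_fun_add A (hDDd w (b i) x) hlie_d (b i),
    covDeriv_lie_apply A (hFd w (b i) x) (hφd x) (b i), two_smul]
  abel

end CovAlgebra

/-! ### The evolution of `∇F` under the flow -/

section GradEvolution

variable {E : Type*} [NormedAddCommGroup E] [InnerProductSpace ℝ E] [FiniteDimensional ℝ E]
variable {𝔸 : Type*} [NormedRing 𝔸] [NormedAlgebra ℝ 𝔸]
variable {ι : Type*} [Fintype ι]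

/-- **Evolution of the covariant derivative of the curvature under the Yang–Mills heat flow**
(flat space). Let `A` be jointly smooth on `𝒯 × E` (`𝒯` open) and solve `∂ₜA = div_A F_A` on `𝒯`.
Then for `t ∈ 𝒯`, every `x` and vectors `u v w`, in any orthonormal frame `b`,
`∂ₜ (D_wF(u,v)) = ∑ᵢ DᵢDᵢ(D_wF(u,v))
  + 2 ∑ᵢ ([F(w,bᵢ), DᵢF(u,v)] + [D_wF(u,bᵢ), F(bᵢ,v)] + [F(u,bᵢ), D_wF(bᵢ,v)])`
("`(∂ₜ + ∇^*∇)∇F = F # ∇F`": differentiate `D_wF` in time (`∂ₜD = D∂ₜ + [Ȧ, ·]`,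
`∂ₜF = −∇^*∇F + F#F`), commute `D_w` through `∇^*∇`; the terms `[DᵢF(w,bᵢ), F]` and `[Ȧ_w, F]`
cancel because `Ȧ_w = div F(w) = −∑ᵢDᵢF(w,bᵢ)`). [cite: Waldron2016, Lemma 3.1 (k = 1);
Waldron2019, Prop. 3.1(a)] -/
theorem hasDerivAt_covDeriv_curvature_of_flow (b : OrthonormalBasis ι ℝ E)
    {A : ℝ → Connection E 𝔸} {𝒯 : Set ℝ} (h𝒯 : IsOpen 𝒯)
    (hA : ContDiffOn ℝ ∞ (fun p : ℝ × E => A p.1 p.2) (𝒯 ×ˢ (univ : Set E)))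
    (hpde : ∀ ⦃s : ℝ⦄, s ∈ 𝒯 → ∀ y w, deriv (fun s' => A s' y w) s = divCurvature (A s) y w)
    {t : ℝ} (ht : t ∈ 𝒯) (x u v w : E) :
    HasDerivAt (fun s => covDeriv (A s) (fun z => curvature (A s) z u v) x w)
      (∑ i, covDeriv (A t) (fun y => covDeriv (A t)
          (fun z => covDeriv (A t) (fun z' => curvature (A t) z' u v) z w) y (b i)) x (b i) +
        (2 : ℝ) • ∑ i, (⁅curvature (A t) x w (b i),
            covDeriv (A t) (fun z => curvature (A t) z u v) x (b i)⁆ +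
          ⁅covDeriv (A t) (fun z => curvature (A t) z u (b i)) x w, curvature (A t) x (b i) v⁆ +
          ⁅curvature (A t) x u (b i), covDeriv (A t) (fun z => curvature (A t) z (b i) v) x w⁆)) t := by
  have hU : IsOpen (𝒯 ×ˢ (univ : Set E)) := h𝒯.prod isOpen_univ
  have hp : ∀ y, (t, y) ∈ 𝒯 ×ˢ (univ : Set E) := fun y => ⟨ht, mem_univ y⟩
  set Ā : ℝ × E → E →L[ℝ] 𝔸 := fun p => A p.1 p.2 with hĀ
  have hsm : ContDiff ℝ ∞ (A t) := contDiff_slice_of_contDiffOn_prod hA ht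
  have hA2 : ContDiff ℝ 2 (A t) := hsm.of_le ENat.LEInfty.out
  have hA3 : ContDiff ℝ 3 (A t) := hsm.of_le ENat.LEInfty.out
  have hA31 : ContDiff ℝ (3 + 1) (A t) := by
    rw [show (3 : WithTop ℕ∞) + 1 = 4 by norm_num]; exact hsm.of_le ENat.LEInfty.out
  have hA21 : ContDiff ℝ (2 + 1) (A t) := by
    rw [show (2 : WithTop ℕ∞) + 1 = 3 by norm_num]; exact hA3
  have hA12 : ContDiff ℝ (1 + 2) (A t) := by
    rw [show (1 : WithTop ℕ∞) + 2 = 3 by norm_num]; exact hA3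
  -- regularity of the curvature and its covariant derivatives
  have hF3 : ∀ a c, ContDiff ℝ 3 (fun z => curvature (A t) z a c) := fun a c =>
    contDiff_curvature_apply hA31 a c
  have hF2 : ∀ a c, ContDiff ℝ 2 (fun z => curvature (A t) z a c) := fun a c =>
    contDiff_curvature_apply hA21 a c
  have hFd : ∀ a c y, DifferentiableAt ℝ (fun z => curvature (A t) z a c) y := fun a c y =>
    ((hF2 a c).differentiable two_ne_zero) y
  have hDFd : ∀ a c d y, DifferentiableAt ℝ
      (fun z => covDeriv (A t) (fun z' => curvature (A t) z' a c) z d) y := fun a c d y =>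
    ((contDiff_covDeriv_curvature_apply (k := 1) hA12 a c d).differentiable one_ne_zero) y
  have hDDFd : ∀ a c d d' y, DifferentiableAt ℝ (fun y' => covDeriv (A t)
      (fun z => covDeriv (A t) (fun z' => curvature (A t) z' a c) z d) y' d') y := by
    intro a c d d' y
    have h2 : ContDiff ℝ (1 + 1) (fun z => covDeriv (A t) (fun z' => curvature (A t) z' a c) z d) := by
      rw [show (1 : WithTop ℕ∞) + 1 = 2 by norm_num]
      exact contDiff_covDeriv_curvature_apply (k := 2) (by
        rw [show (2 : WithTop ℕ∞) + 2 = 4 by norm_num]; exact hsm.of_le ENat.LEInfty.out) a c d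
    exact ((contDiff_covDeriv_apply (hsm.of_le ENat.LEInfty.out) h2 d').differentiable
      one_ne_zero) y
  -- ### the time derivative `Ȧ(t) = div F`
  have hdiv : ∀ y a, fderiv ℝ (fun p : ℝ × E => A p.1 p.2) (t, y) ((1 : ℝ), (0 : E)) a =
      ∑ i, covDeriv (A t) (fun z => curvature (A t) z (b i) a) y (b i) := by
    intro y a
    have h := (hasDerivAt_slice_apply hU hA (by simp) (hp y) a).deriv
    rw [hpde ht y a] at h
    rw [← h, divCurvature_eq_sum_orthonormalBasis b (A t) hA2 y a]
  -- ### Step 1: `∂ₜ(D_wF) = D_w(∂ₜF) + [𝒜_w, F]`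
  have hΦ : ContDiffOn ℝ ∞ (fun p : ℝ × E => curvature (A p.1) p.2 u v) (𝒯 ×ˢ (univ : Set E)) :=
    contDiffOn_curvature_joint hU hA (m := ∞) (by norm_cast) u v
  have h1 := hasDerivAt_covDeriv_timeSlice hU hA hΦ ENat.LEInfty.out (hp x) w
  -- ### Step 2: `∂ₜF(t, y) = ∑ᵢ DᵢDᵢF(u,v)(y) + 2∑ᵢ[F(u,bᵢ), F(bᵢ,v)]` as a function of `y`
  have hFt : (fun y => fderiv ℝ (fun p : ℝ × E => curvature (A p.1) p.2 u v) (t, y)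
      ((1 : ℝ), (0 : E))) = fun y =>
      ∑ i, covDeriv (A t) (fun y' => covDeriv (A t) (fun z => curvature (A t) z u v) y' (b i)) y
        (b i) + (2 : ℝ) • ∑ i, ⁅curvature (A t) y u (b i), curvature (A t) y (b i) v⁆ := by
    funext y
    exact (hasDerivAt_timeSlice hU hΦ (by simp) (hp y)).unique
      (hasDerivAt_curvature_of_flow b h𝒯 hA hpde ht y u v)
  rw [hFt] at h1
  refine h1.congr_deriv ?_
  -- ### Step 3: algebra
  have hlie_d : ∀ i y, DifferentiableAt ℝ
      (fun y => ⁅curvature (A t) y u (b i), curvature (A t) y (b i) v⁆) y := by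
    intro i y
    have heq : (fun y => ⁅curvature (A t) y u (b i), curvature (A t) y (b i) v⁆) =
        fun y => curvature (A t) y u (b i) * curvature (A t) y (b i) v -
          curvature (A t) y (b i) v * curvature (A t) y u (b i) := funext fun y => Ring.lie_def _ _
    rw [heq]
    exact ((hFd u (b i) y).mul (hFd (b i) v y)).sub ((hFd (b i) v y).mul (hFd u (b i) y))
  have hsum_d : ∀ y, DifferentiableAt ℝ (fun y => ∑ i, covDeriv (A t)
      (fun y' => covDeriv (A t) (fun z => curvature (A t) z u v) y' (b i)) y (b i)) y := fun y =>
    DifferentiableAt.fun_sum fun i _ => hDDFd u v (b i) (b i) y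
  have hsmul_d : ∀ y, DifferentiableAt ℝ
      (fun y => (2 : ℝ) • ∑ i, ⁅curvature (A t) y u (b i), curvature (A t) y (b i) v⁆) y := fun y =>
    (differentiableAt_const (2 : ℝ)).smul (DifferentiableAt.fun_sum fun i _ => hlie_d i y)
  -- `D_w` of the sum of the two pieces
  rw [covDeriv_fun_add (A t) (hsum_d x) (hsmul_d x) w,
    covDeriv_sum_covDeriv_covDeriv_eq b (A t) hA2 (hF3 u v) x w,
    covDeriv_fun_smul (A t) 2 (DifferentiableAt.fun_sum fun i _ => hlie_d i x) w,
    covDeriv_fun_sum Finset.univ (A t) (fun i _ => hlie_d i x) w]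
  have hL : ∑ i, covDeriv (A t) (fun y => ⁅curvature (A t) y u (b i), curvature (A t) y (b i) v⁆) x w =
      ∑ i, (⁅covDeriv (A t) (fun z => curvature (A t) z u (b i)) x w, curvature (A t) x (b i) v⁆ +
        ⁅curvature (A t) x u (b i), covDeriv (A t) (fun z => curvature (A t) z (b i) v) x w⁆) :=
    Finset.sum_congr rfl fun i _ => covDeriv_lie_apply (A t) (hFd u (b i) x) (hFd (b i) v x) w
  -- the cancellation `∑ᵢ [DᵢF(w,bᵢ), F] + [Ȧ_w, F] = 0`
  have hcancel : ∑ i, ⁅covDeriv (A t) (fun z => curvature (A t) z w (b i)) x (b i),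
      curvature (A t) x u v⁆ +
      ⁅fderiv ℝ (fun p : ℝ × E => A p.1 p.2) (t, x) ((1 : ℝ), (0 : E)) w, curvature (A t) x u v⁆ =
      0 := by
    rw [hdiv x w]
    simp only [Ring.lie_def, Finset.sum_mul, Finset.mul_sum, ← Finset.sum_sub_distrib,
      ← Finset.sum_add_distrib]
    refine Finset.sum_eq_zero fun i _ => ?_
    rw [show (fun z => curvature (A t) z (b i) w) = fun z => -curvature (A t) z w (b i) from
      funext fun z => curvature_antisymm (A t) z (b i) w, covDeriv_fun_neg]
    noncomm_ring
  rw [hL, eq_neg_of_add_eq_zero_right hcancel]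
  simp only [smul_add, Finset.smul_sum, Finset.sum_add_distrib]
  abel

end GradEvolution

/-! ### The Bochner inequality for `|∇F|²` -/

section GradBochner

open scoped Matrix.Norms.Frobenius

attribute [local instance] frobeniusInnerProductSpace

variable {m : Type*} [Fintype m] [DecidableEq m]
variable {E : Type*} [NormedAddCommGroup E] [InnerProductSpace ℝ E] [FiniteDimensional ℝ E]
variable {ι : Type*} [Fintype ι] [LinearOrder ι]

omit [FiniteDimensional ℝ E] [LinearOrder ι] in
/-- **The Laplacian of a sum of squared norms of sections** (covariant Leibniz rule twice): for a
`C¹` connection `A`, `𝔲(m)`-valued, a finite family of `C²` sections `ψₐ` and an orthonormal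
frame `b`, `∑ₗ ∂ₗ∂ₗ ∑ₐ ‖ψₐ‖² = 2∑ₗ∑ₐ ‖Dₗψₐ‖² + 2∑ₗ∑ₐ ⟨ψₐ, DₗDₗψₐ⟩`. [folklore] -/
theorem sum_fderiv_fderiv_sum_norm_sq_eq {κ : Type*} [Fintype κ] (b : OrthonormalBasis ι ℝ E)
    {A : Connection E (Matrix m m ℂ)} (hA : ContDiff ℝ 1 A)
    (hval : A.IsValuedIn (skewAdjoint.submodule ℝ (Matrix m m ℂ)))
    {ψ : κ → E → Matrix m m ℂ} (hψ : ∀ a, ContDiff ℝ 2 (ψ a)) (x : E) :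
    ∑ l, fderiv ℝ (fun y => fderiv ℝ (fun z => ∑ a, ‖ψ a z‖ ^ 2) y (b l)) x (b l) =
      2 * ∑ l, ∑ a, ‖covDeriv A (ψ a) x (b l)‖ ^ 2 +
        2 * ∑ l, ∑ a, ⟪ψ a x, covDeriv A (fun y => covDeriv A (ψ a) y (b l)) x (b l)⟫ := by
  have hψd : ∀ a, Differentiable ℝ (ψ a) := fun a => (hψ a).differentiable two_ne_zero
  have hDd : ∀ l a, Differentiable ℝ fun y => covDeriv A (ψ a) y (b l) := fun l a y =>
    differentiableAt_covDeriv_apply hA (hψ a) (b l) y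
  -- first derivatives
  have h1 : ∀ l, (fun y => fderiv ℝ (fun z => ∑ a, ‖ψ a z‖ ^ 2) y (b l)) =
      fun y => ∑ a, 2 * ⟪ψ a y, covDeriv A (ψ a) y (b l)⟫ := by
    intro l
    funext y
    rw [fderiv_fun_sum fun a _ => ((hψd a) y).norm_sq ℝ, FunLike.coe_sum, Finset.sum_apply]
    exact Finset.sum_congr rfl fun a _ =>
      fderiv_norm_sq_eq_two_inner_covDeriv ((hψd a) y) (b l) (hval y (b l))
  simp_rw [h1]
  rw [Finset.mul_sum, Finset.mul_sum, ← Finset.sum_add_distrib]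
  refine Finset.sum_congr rfl fun l _ => ?_
  have hterm : ∀ a, DifferentiableAt ℝ (fun y => 2 * ⟪ψ a y, covDeriv A (ψ a) y (b l)⟫) x :=
    fun a => (((hψd a) x).inner ℝ ((hDd l a) x)).const_mul 2
  rw [fderiv_fun_sum fun a _ => hterm a, FunLike.coe_sum, Finset.sum_apply, Finset.mul_sum,
    Finset.mul_sum, ← Finset.sum_add_distrib]
  refine Finset.sum_congr rfl fun a _ => ?_
  rw [fderiv_const_mul (((hψd a) x).inner ℝ ((hDd l a) x)), smul_apply, smul_eq_mul,
    fderiv_frobenius_inner_eq_covDeriv ((hψd a) x) ((hDd l a) x) (b l) (hval x (b l)),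
    real_inner_self_eq_norm_sq]
  ring

omit [LinearOrder ι] in
/-- `(∑ⱼ aⱼ)² ≤ card · ∑ⱼ aⱼ²` (Cauchy–Schwarz). [folklore] -/
private theorem sq_sum_le_card_mul_sum_sq'' (a : ι → ℝ) :
    (∑ j, a j) ^ 2 ≤ Fintype.card ι * ∑ j, a j ^ 2 := by
  have h := sq_sum_le_card_mul_sum_sq (s := Finset.univ) (f := a)
  simpa using h

omit [LinearOrder ι] in
/-- `∑ᵢⱼ aᵢ aⱼ = (∑ aᵢ)²  ≤ card · ∑ aᵢ²` — the mixed-sum form. [folklore] -/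
private theorem sum_sum_mul_le_card_mul_sum_sq (a : ι → ℝ) :
    ∑ i, ∑ l, a i * a l ≤ Fintype.card ι * ∑ i, a i ^ 2 := by
  rw [← Finset.sum_mul_sum, ← sq]
  exact sq_sum_le_card_mul_sum_sq'' a

omit [LinearOrder ι] in
/-- Moving the innermost of four sums outermost. [folklore] -/
private theorem sum4_comm_last {X : Type*} [AddCommMonoid X] (f : ι → ι → ι → ι → X) :
    ∑ i, ∑ j, ∑ k, ∑ l, f i j k l = ∑ l, ∑ i, ∑ j, ∑ k, f i j k l :=
  calc ∑ i, ∑ j, ∑ k, ∑ l, f i j k l = ∑ i, ∑ j, ∑ l, ∑ k, f i j k l :=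
        Finset.sum_congr rfl fun i _ => Finset.sum_congr rfl fun j _ =>
          Finset.sum_comm (f := fun k l => f i j k l)
    _ = ∑ i, ∑ l, ∑ j, ∑ k, f i j k l :=
        Finset.sum_congr rfl fun i _ => Finset.sum_comm (f := fun j l => ∑ k, f i j k l)
    _ = ∑ l, ∑ i, ∑ j, ∑ k, f i j k l := Finset.sum_comm (f := fun i l => ∑ j, ∑ k, f i j k l)

/-- **The Bochner inequality for `|∇F|²` along the Yang–Mills heat flow** (flat space; the `k = 1`
derivative estimate, "`(∂ₜ + ∇^*∇)∇F = F # ∇F`"). For a jointly smooth `𝔲(m)`-valued solution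
on an open time set `𝒯 ∋ t` and an orthonormal frame `b`, with
`N = ∑_{ijk} ‖DᵢF_{jk}‖²` and `e = ymDensityOfBasis b`, at every `x`:
`∂ₜN − ∑ₗ∂ₗ∂ₗN ≤ −2∑_{lijk}‖DₗDᵢF_{jk}‖² + 24√2 (card ι) √e · N`.
[cite: Waldron2016, Lemma 3.1 (k = 1); Waldron2019, Prop. 3.1(a)] -/
theorem deriv_gradDensity_sub_laplacian_le (b : OrthonormalBasis ι ℝ E)
    {A : ℝ → Connection E (Matrix m m ℂ)} {𝒯 : Set ℝ} (h𝒯 : IsOpen 𝒯)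
    (hA : ContDiffOn ℝ ∞ (fun p : ℝ × E => A p.1 p.2) (𝒯 ×ˢ (univ : Set E)))
    (hval : ∀ ⦃s : ℝ⦄, s ∈ 𝒯 → (A s).IsValuedIn (skewAdjoint.submodule ℝ (Matrix m m ℂ)))
    (hpde : ∀ ⦃s : ℝ⦄, s ∈ 𝒯 → ∀ y w, deriv (fun s' => A s' y w) s = divCurvature (A s) y w)
    {t : ℝ} (ht : t ∈ 𝒯) (x : E) :
    deriv (fun s => ∑ i, ∑ j, ∑ k,
        ‖covDeriv (A s) (fun z => curvature (A s) z (b j) (b k)) x (b i)‖ ^ 2) t -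
        ∑ l, fderiv ℝ (fun y => fderiv ℝ (fun z => ∑ i, ∑ j, ∑ k,
          ‖covDeriv (A t) (fun z' => curvature (A t) z' (b j) (b k)) z (b i)‖ ^ 2) y (b l)) x (b l) ≤
      -(2 * ∑ l, ∑ i, ∑ j, ∑ k, ‖covDeriv (A t) (fun y => covDeriv (A t)
          (fun z => curvature (A t) z (b j) (b k)) y (b i)) x (b l)‖ ^ 2) +
        24 * Real.sqrt 2 * (Fintype.card ι : ℝ) * Real.sqrt (ymDensityOfBasis b (A t) x) *
          ∑ i, ∑ j, ∑ k, ‖covDeriv (A t) (fun z => curvature (A t) z (b j) (b k)) x (b i)‖ ^ 2 := by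
  have hsm : ContDiff ℝ ∞ (A t) := contDiff_slice_of_contDiffOn_prod hA ht
  have hA1 : ContDiff ℝ 1 (A t) := hsm.of_le ENat.LEInfty.out
  have hA22 : ContDiff ℝ (2 + 2) (A t) := by
    rw [show (2 : WithTop ℕ∞) + 2 = 4 by norm_num]; exact hsm.of_le ENat.LEInfty.out
  -- ### notation
  set F : ι → ι → Matrix m m ℂ := fun j k => curvature (A t) x (b j) (b k) with hF
  set Gf : ι → ι → ι → E → Matrix m m ℂ := fun i j k y =>
    covDeriv (A t) (fun z => curvature (A t) z (b j) (b k)) y (b i) with hGf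
  set G : ι → ι → ι → Matrix m m ℂ := fun i j k => Gf i j k x with hG
  have hGf2 : ∀ i j k, ContDiff ℝ 2 (Gf i j k) := fun i j k =>
    contDiff_covDeriv_curvature_apply hA22 (b j) (b k) (b i)
  -- ### the time derivative of `N`
  set L : ι → ι → ι → Matrix m m ℂ := fun i j k =>
    ∑ l, covDeriv (A t) (fun y => covDeriv (A t) (Gf i j k) y (b l)) x (b l) with hL
  set Q : ι → ι → ι → Matrix m m ℂ := fun i j k =>
    ∑ l, (⁅curvature (A t) x (b i) (b l), Gf l j k x⁆ +
      ⁅Gf i j l x, curvature (A t) x (b l) (b k)⁆ + ⁅curvature (A t) x (b j) (b l), Gf i l k x⁆) with hQ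
  have hijk : ∀ i j k, HasDerivAt
      (fun s => ‖covDeriv (A s) (fun z => curvature (A s) z (b j) (b k)) x (b i)‖ ^ 2)
      (2 * ⟪G i j k, L i j k + (2 : ℝ) • Q i j k⟫) t := fun i j k =>
    (hasDerivAt_covDeriv_curvature_of_flow b h𝒯 hA hpde ht x (b j) (b k) (b i)).norm_sq
  have hN : HasDerivAt (fun s => ∑ i, ∑ j, ∑ k,
      ‖covDeriv (A s) (fun z => curvature (A s) z (b j) (b k)) x (b i)‖ ^ 2)
      (∑ i, ∑ j, ∑ k, 2 * ⟪G i j k, L i j k + (2 : ℝ) • Q i j k⟫) t :=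
    HasDerivAt.fun_sum fun i _ => HasDerivAt.fun_sum fun j _ => HasDerivAt.fun_sum fun k _ => hijk i j k
  rw [hN.deriv]
  -- ### the Laplacian of `N` via the generic Leibniz computation over `κ = ι × ι × ι`
  have hψ : ∀ p : ι × ι × ι, ContDiff ℝ 2 (Gf p.1 p.2.1 p.2.2) := fun p => hGf2 _ _ _
  have hlap := sum_fderiv_fderiv_sum_norm_sq_eq (κ := ι × ι × ι) b hA1 (hval ht)
    (ψ := fun p => Gf p.1 p.2.1 p.2.2) hψ x
  have htriple : ∀ (f : ι → ι → ι → ℝ), ∑ p : ι × ι × ι, f p.1 p.2.1 p.2.2 = ∑ i, ∑ j, ∑ k, f i j k := by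
    intro f
    simp only [Fintype.sum_prod_type]
  have hfun : (fun z => ∑ p : ι × ι × ι, ‖Gf p.1 p.2.1 p.2.2 z‖ ^ 2) = fun z => ∑ i, ∑ j, ∑ k,
      ‖covDeriv (A t) (fun z' => curvature (A t) z' (b j) (b k)) z (b i)‖ ^ 2 := by
    funext z
    exact htriple fun i j k => ‖Gf i j k z‖ ^ 2
  rw [hfun] at hlap
  rw [hlap]
  simp only [Fintype.sum_prod_type]
  -- ### bookkeeping
  have e1 : ∑ i, ∑ j, ∑ k, 2 * ⟪G i j k, L i j k + (2 : ℝ) • Q i j k⟫ =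
      2 * (∑ i, ∑ j, ∑ k, ⟪G i j k, L i j k⟫) + 4 * ∑ i, ∑ j, ∑ k, ⟪G i j k, Q i j k⟫ := by
    simp only [inner_add_right, inner_smul_right, mul_add, Finset.sum_add_distrib, ← Finset.mul_sum]
    ring
  have e2 : ∑ i, ∑ j, ∑ k, ⟪G i j k, L i j k⟫ = ∑ l, ∑ i, ∑ j, ∑ k,
      ⟪Gf i j k x, covDeriv (A t) (fun y => covDeriv (A t) (Gf i j k) y (b l)) x (b l)⟫ := by
    simp only [hL, hG, inner_sum]
    exact sum4_comm_last _
  rw [e1, e2]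
  -- ### the cubic term
  set ee : ℝ := ymDensityOfBasis b (A t) x with hee
  set N : ℝ := ∑ i, ∑ j, ∑ k, ‖G i j k‖ ^ 2 with hNdef
  have hF : ∀ j k, ‖curvature (A t) x (b j) (b k)‖ ≤ Real.sqrt (2 * ee) := fun j k =>
    norm_curvature_apply_le_sqrt b (A t) x j k
  set c : ℝ := 2 * Real.sqrt (2 * ee) with hc
  have hc0 : 0 ≤ c := by positivity
  -- each bracket term is bounded by `c ‖G‖ ‖G'‖`
  have hbr1 : ∀ (X Y : Matrix m m ℂ) (j k : ι), ⟪X, ⁅curvature (A t) x (b j) (b k), Y⁆⟫ ≤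
      c * (‖X‖ * ‖Y‖) := fun X Y j k =>
    calc ⟪X, ⁅curvature (A t) x (b j) (b k), Y⁆⟫ ≤ |⟪X, ⁅curvature (A t) x (b j) (b k), Y⁆⟫| :=
          le_abs_self _
      _ ≤ 2 * ‖X‖ * ‖curvature (A t) x (b j) (b k)‖ * ‖Y‖ := abs_frobenius_inner_lie_le _ _ _
      _ ≤ 2 * ‖X‖ * Real.sqrt (2 * ee) * ‖Y‖ := by gcongr; exact hF j k
      _ = c * (‖X‖ * ‖Y‖) := by rw [hc]; ring
  have hbr2 : ∀ (X Y : Matrix m m ℂ) (j k : ι), ⟪X, ⁅Y, curvature (A t) x (b j) (b k)⁆⟫ ≤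
      c * (‖X‖ * ‖Y‖) := fun X Y j k =>
    calc ⟪X, ⁅Y, curvature (A t) x (b j) (b k)⁆⟫ ≤ |⟪X, ⁅Y, curvature (A t) x (b j) (b k)⁆⟫| :=
          le_abs_self _
      _ ≤ 2 * ‖X‖ * ‖Y‖ * ‖curvature (A t) x (b j) (b k)‖ := abs_frobenius_inner_lie_le _ _ _
      _ ≤ 2 * ‖X‖ * ‖Y‖ * Real.sqrt (2 * ee) := by gcongr; exact hF j k
      _ = c * (‖X‖ * ‖Y‖) := by rw [hc]; ring
  have hQle : ∀ i j k, ⟪G i j k, Q i j k⟫ ≤ c * ∑ l, (‖G i j k‖ * ‖G l j k‖ +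
      ‖G i j k‖ * ‖G i j l‖ + ‖G i j k‖ * ‖G i l k‖) := by
    intro i j k
    simp only [hQ, hG, inner_sum, inner_add_right, Finset.mul_sum, mul_add]
    refine Finset.sum_le_sum fun l _ => add_le_add (add_le_add ?_ ?_) ?_
    · exact hbr1 _ _ i l
    · exact hbr2 _ _ l k
    · exact hbr1 _ _ j l
  -- the three quartic sums are each `≤ card · N`
  have hT2 : ∑ i, ∑ j, ∑ k, ∑ l, ‖G i j k‖ * ‖G i j l‖ ≤ Fintype.card ι * N := by
    rw [hNdef, Finset.mul_sum]
    refine Finset.sum_le_sum fun i _ => ?_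
    rw [Finset.mul_sum]
    refine Finset.sum_le_sum fun j _ => ?_
    exact sum_sum_mul_le_card_mul_sum_sq fun k => ‖G i j k‖
  have hT1 : ∑ i, ∑ j, ∑ k, ∑ l, ‖G i j k‖ * ‖G l j k‖ ≤ Fintype.card ι * N := by
    -- reorder to `∑ j, ∑ k, ∑ i, ∑ l`
    have hre : ∑ i, ∑ j, ∑ k, ∑ l, ‖G i j k‖ * ‖G l j k‖ =
        ∑ j, ∑ k, ∑ i, ∑ l, ‖G i j k‖ * ‖G l j k‖ :=
      calc _ = ∑ j, ∑ i, ∑ k, ∑ l, ‖G i j k‖ * ‖G l j k‖ :=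
            Finset.sum_comm (f := fun i j => ∑ k, ∑ l, ‖G i j k‖ * ‖G l j k‖)
        _ = ∑ j, ∑ k, ∑ i, ∑ l, ‖G i j k‖ * ‖G l j k‖ :=
            Finset.sum_congr rfl fun j _ =>
              Finset.sum_comm (f := fun i k => ∑ l, ‖G i j k‖ * ‖G l j k‖)
    have hN' : N = ∑ j, ∑ k, ∑ i, ‖G i j k‖ ^ 2 :=
      calc N = ∑ j, ∑ i, ∑ k, ‖G i j k‖ ^ 2 := Finset.sum_comm (f := fun i j => ∑ k, ‖G i j k‖ ^ 2)
        _ = ∑ j, ∑ k, ∑ i, ‖G i j k‖ ^ 2 :=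
            Finset.sum_congr rfl fun j _ => Finset.sum_comm (f := fun i k => ‖G i j k‖ ^ 2)
    rw [hre, hN', Finset.mul_sum]
    refine Finset.sum_le_sum fun j _ => ?_
    rw [Finset.mul_sum]
    refine Finset.sum_le_sum fun k _ => ?_
    exact sum_sum_mul_le_card_mul_sum_sq fun i => ‖G i j k‖
  have hT3 : ∑ i, ∑ j, ∑ k, ∑ l, ‖G i j k‖ * ‖G i l k‖ ≤ Fintype.card ι * N := by
    have hre : ∑ i, ∑ j, ∑ k, ∑ l, ‖G i j k‖ * ‖G i l k‖ =
        ∑ i, ∑ k, ∑ j, ∑ l, ‖G i j k‖ * ‖G i l k‖ :=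
      Finset.sum_congr rfl fun i _ =>
        Finset.sum_comm (f := fun j k => ∑ l, ‖G i j k‖ * ‖G i l k‖)
    have hN' : N = ∑ i, ∑ k, ∑ j, ‖G i j k‖ ^ 2 :=
      Finset.sum_congr rfl fun i _ => Finset.sum_comm (f := fun j k => ‖G i j k‖ ^ 2)
    rw [hre, hN', Finset.mul_sum]
    refine Finset.sum_le_sum fun i _ => ?_
    rw [Finset.mul_sum]
    refine Finset.sum_le_sum fun k _ => ?_
    exact sum_sum_mul_le_card_mul_sum_sq fun j => ‖G i j k‖
  have hGQ : ∑ i, ∑ j, ∑ k, ⟪G i j k, Q i j k⟫ ≤ c * (3 * (Fintype.card ι * N)) := by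
    calc ∑ i, ∑ j, ∑ k, ⟪G i j k, Q i j k⟫
        ≤ ∑ i, ∑ j, ∑ k, c * ∑ l, (‖G i j k‖ * ‖G l j k‖ + ‖G i j k‖ * ‖G i j l‖ +
            ‖G i j k‖ * ‖G i l k‖) :=
          Finset.sum_le_sum fun i _ => Finset.sum_le_sum fun j _ => Finset.sum_le_sum fun k _ =>
            hQle i j k
      _ = c * ((∑ i, ∑ j, ∑ k, ∑ l, ‖G i j k‖ * ‖G l j k‖) +
            (∑ i, ∑ j, ∑ k, ∑ l, ‖G i j k‖ * ‖G i j l‖) +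
            ∑ i, ∑ j, ∑ k, ∑ l, ‖G i j k‖ * ‖G i l k‖) := by
          simp only [Finset.mul_sum, Finset.sum_add_distrib, mul_add]
      _ ≤ c * (Fintype.card ι * N + Fintype.card ι * N + Fintype.card ι * N) := by
          gcongr c * (?_ + ?_ + ?_)
      _ = c * (3 * (Fintype.card ι * N)) := by ring
  have hsqrt : Real.sqrt (2 * ee) = Real.sqrt 2 * Real.sqrt ee := Real.sqrt_mul (by norm_num) ee
  have hfin : 4 * ∑ i, ∑ j, ∑ k, ⟪G i j k, Q i j k⟫ ≤
      24 * Real.sqrt 2 * (Fintype.card ι : ℝ) * Real.sqrt ee * N := by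
    calc 4 * ∑ i, ∑ j, ∑ k, ⟪G i j k, Q i j k⟫ ≤ 4 * (c * (3 * (Fintype.card ι * N))) := by
          gcongr
      _ = 24 * Real.sqrt 2 * (Fintype.card ι : ℝ) * Real.sqrt ee * N := by
          rw [hc, hsqrt]; ring
  simp only [hNdef, hG] at hfin
  linarith

end GradBochner

end Literature.MathematicalPhysics.QuantumLattice
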